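import Literature.AlgebraicGeometry.Motives.HodgeStructureCorrespondencesLefschetzGroup
import HarnessLib

/-!
# Milne 1999, Cor. 5.8 and Thm. 5.9 AS PRINTED: the Künneth components of the diagonal, and the correspondences `Λ`, `ᶜΛ`, `∗`
# (indeed the class of every element of `ℚ[L, Λ]`), are Lefschetz CLASSES on `A × A` — on the polarized-`ℚ`-Hodge-structure carrier

[topic AlgebraicGeometry/Motives]

Layer `Literature/AlgebraicGeometry/Motives`, lane `lit-hodgefound` (Track 2 foundations library; prover seat `lit-hodgefound-p34`,
generation 32, row g32-#4). THEOREMS ONLY (no `def`, no named fact, no instance, no notation; net debt `0`). Sequel of rows g32-#1/#2/#3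
(the dictionary `u ↦ ū`, its inverse `T ↦ [T] = corrEquiv⁻¹ T ∈ ⋀(V ⊕ V) = H•(A × A)`, and Prop. 5.7 as printed:
`Polarization.corrEquiv_symm_mem_adjoin_hodgeClasses_two_prod_self_iff` — `[T]` is Lefschetz iff a complexification `T_ℂ` of `T`
commutes with `⋀γ` for every `γ ∈ S(H)(ℂ)`) and of the operator-form files g29-#4/#6, g30-#2, g31-#3/#7 (the operators
`e_E = L`, `*_L`, `*_L e_E *_L = Λ`, `lefschetzDual = ᶜΛ`, `hodgeStar = ∗`, `weylStar = w`, `andreStar = *_H`, the Künneth projectors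
all lie in `ℚ[e_E, *_L] = ℚ[L, Λ]`, and every element of `ℂ[e_{ΘE}, *_{L,ℂ}]` commutes with `S(H)(ℂ)`). What was "operator shadow" there
is here the printed statement: THE CLASSES in `H•(A × A)` are Lefschetz.

## Source, VERBATIM

J. S. Milne, *Lefschetz classes on abelian varieties*, Duke Math. J. **96** (1999) [Milne1999LefschetzClasses] (held text
`paper:doi-10-1215-s0012-7094-99-09620-5`, p0026–p0027 = pp. 664–665): "COROLLARY 5.8. For any abelian variety `A` over `Ω`, the
Künneth components of the diagonal are Lefschetz. *Proof.* The projection operator `H^*(A) → H^s(A)` commutes with the action of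
`L(A)`. […] For `x = Σ Lⁱxᵢ ∈ H^s(X)`, define `Λx = Σ_{i ≥ s−d, 1} L^{i−1}xᵢ`, `ᶜΛx = Σ_{i ≥ s−d, 1} i(d−s+i+1) L^{i−1}xᵢ`,
`∗x = Σ_{i ≥ s−d, 0} (−1)^{(s−2i)(s−2i+1)/2} L^{d−s+i}xᵢ`. THEOREM 5.9. Let `A` be an abelian variety over `Ω`. The correspondences
`Λ`, `ᶜΛ`, and `∗` between `A` and itself are all Lefschetz. *Proof.* It is known (e.g., Kleiman 1968, p367) that `Λ`, regarded as a
map of cohomology groups, is inverse to `L`. Since the latter is Lefschetz, it commutes with the action of `L(A)`, which implies that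
the same is true of `Λ`, which is therefore Lefschetz. Consequently, all elements of the `ℚ`-algebra `ℚ[L, Λ]` are Lefschetz. Since
this algebra contains `ᶜΛ` and `∗` (Kleiman 1968, 1.4.4), this completes the proof."
Y. André, *Pour une théorie inconditionnelle des motifs*, Publ. Math. IHÉS 83 (1996) [Andre1996Motifs], Prop. 1.2 (p. 11): "Les
sous-algèbres `Q_ν[L, *_L]`, `Q_ν[L, *_H]`, `Q_ν[L, *_L L *_L]`, `Q_ν[L, ᶜΛ]` de `End H(X)` sont égales et contiennent les projecteurs de
Künneth" (the tree: `*_L e *_L` = Milne's `Λ`, `lefschetzDual` = `ᶜΛ`, `hodgeStar` = Milne's `∗`, `andreStar` = André's `*_H`, g31 finding).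

## What is PROVED (`E = E_Q`, `dim V = 2g`, `n` odd, `[T] := (Q.isSymplectic_lefschetzClass hn hg).corrEquiv.symm T ∈ ⋀(V × V)`,
## "Lefschetz" = `∈ ℚ[B¹(H ⊕ H)] = Algebra.adjoin ℚ (Hdg ⋀²(H ⊕ H))`)

* §1 THE `ℚ → ℂ` DICTIONARY OF `ℚ[e_ω, *_L]` (gen-31 pointer (β)): `proj_toComplexAlg`, `map_proj` (the Künneth projectors commute with
  `Θ` and with every `⋀f`), **`IsSymplectic.exists_mem_adjoin_lefschetzStar_toComplexAlg`: every `T ∈ ℚ[e_ω, *_L]` has a (unique,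
  `toComplexAlg_linearMap_eq_of_comp_eq`) complexification `T_ℂ ∈ ℂ[e_{Θω}, *_{L,ℂ}]`, `T_ℂ Θ = Θ T`** (generators: `Θ(ω ∧ x) = Θω ∧ Θx`,
  `Θ *_L = *_{L,ℂ} Θ` of row g29-#6; `Algebra.adjoin_induction`).
* §2 **THM. 5.9 AS PRINTED, general form — `Polarization.corrEquiv_symm_mem_adjoin_hodgeClasses_two_of_mem_adjoin_lefschetzStar`: for every
  `T ∈ ℚ[e_E, *_L] = ℚ[L, Λ]`, the class `[T] ∈ H•(A × A)` is Lefschetz** ("Consequently, all elements of the `ℚ`-algebra `ℚ[L, Λ]` are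
  Lefschetz": `T_ℂ` commutes with `S(H)(ℂ)` by g29-#6 `Polarization.commute_map_of_mem_adjoin_lefschetzStar`, then Prop. 5.7 of row g32-#3);
  the named correspondences: **`…_mul_lefschetzClass_…` (`[L]`), `…_lefschetzStar_…` (`[*_L]`, "its inverse"), `…_conj_lefschetzStar_…`
  (`[Λ] = [*_L L *_L]`), `…_lefschetzDual_…` (`[ᶜΛ]`, `g ≥ 1`), `…_hodgeStar_…` (`[∗]`)** — THM. 5.9 — and `…_weylStar_…` (`[w]`),
  `…_andreStar_…` (`[*_H]`).
* §3 **COR. 5.8 AS PRINTED — `Polarization.corrEquiv_symm_proj_mem_adjoin_hodgeClasses_two`: the class `[π_k]` of each Künneth projector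
  `π_k : H• → Hᵏ ⊂ H•` is Lefschetz** (Milne's own proof: `π_k` commutes with EVERY `⋀γ`; no `g ≥ 1` needed), `IsSymplectic.sum_range_proj`
  (`Σ_{k ≤ 2g} π_k = id`), **`Polarization.sum_corrEquiv_symm_proj` (`Σ_{k ≤ 2g} [π_k] = [id] = [Δ]`: they ARE the Künneth components of the
  class of the diagonal)**, `Polarization.corrEquiv_symm_id_mem_adjoin_hodgeClasses_two` (`[Δ]` is Lefschetz, Cor. 5.6 for `α = id`).

TWIN NOTICE (RULING 29 bis): torus-forms twins in p08's `Geometry/Kaehler/ComplexTorusLefschetzAlgebraCorrespondences{,AnyBasis}`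
(`IsRiemannForm.corrClass_lefschetzDual/kleimanDual/primitiveProj/lefschetzStar…_mem_divisorClasses`) and
`ComplexTorusCorrespondenceRingKunnethIdempotents` (`kunnethIdem_mem_lefschetzCorr`); nothing imported or restated (different carrier:
abstract polarized `ℚ`-Hodge structures of odd weight; Motives does not import Kaehler).

## References

* [Milne1999LefschetzClasses] J. S. Milne, *Lefschetz classes on abelian varieties*, Duke Math. J. 96 (1999), §5 Cor. 5.8, Thm. 5.9
  (pp. 664–665), Prop. 5.7 (p. 664), Cor. 5.6 (p. 663).
* [Andre1996Motifs] Y. André, *Pour une théorie inconditionnelle des motifs*, Publ. Math. IHÉS 83 (1996), Prop. 1.2 (p. 11).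
* [Kleiman1968AlgebraicCycles] S. Kleiman, *Algebraic cycles and the Weil conjectures* (1968), §1.4, 1.4.4 (cited through Milne).
-/

noncomputable section

open scoped TensorProduct

namespace Literature.AlgebraicGeometry.Motives

universe u

/-! ## §1 The `ℚ → ℂ` dictionary of the algebra `ℚ[e_ω, *_L]` and of the Künneth projectors -/

namespace ExteriorLefschetz

open Literature.Algebra.Lie ExteriorAlgebra

variable {V : Type u} [AddCommGroup V] [Module ℚ V]

/-- **The Künneth projectors commute with `Θ`: `π_k (Θ x) = Θ (π_k x)`** (`Θ` preserves degrees).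
[cite: Milne1999LefschetzClasses, §5 Cor. 5.8 (p. 664)] [cite: BourbakiAlgebraI1989, Ch. III §7 no. 5 Prop. 8] -/
theorem proj_toComplexAlg (k : ℕ) (x : ExteriorAlgebra ℚ V) :
    GradedAlgebra.proj (fun i : ℕ ↦ ⋀[ℂ]^i (ℂ ⊗[ℚ] V)) k (toComplexAlg V x) =
      toComplexAlg V (GradedAlgebra.proj (fun i : ℕ ↦ ⋀[ℚ]^i V) k x) := by
  induction x using DirectSum.Decomposition.inductionOn (fun i : ℕ ↦ ⋀[ℚ]^i V) with
  | zero => simp only [map_zero]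
  | add x x' hx hx' => rw [map_add, map_add, hx, hx', map_add, map_add]
  | @homogeneous i x =>
    rw [GradedAlgebra.proj_apply, GradedAlgebra.proj_apply]
    by_cases hik : i = k
    · subst hik
      rw [DirectSum.decompose_of_mem_same (fun i : ℕ ↦ ⋀[ℂ]^i (ℂ ⊗[ℚ] V)) (toComplexAlg_mem V x.2),
        DirectSum.decompose_of_mem_same (fun i : ℕ ↦ ⋀[ℚ]^i V) x.2]
    · rw [DirectSum.decompose_of_mem_ne (fun i : ℕ ↦ ⋀[ℂ]^i (ℂ ⊗[ℚ] V)) (toComplexAlg_mem V x.2) hik,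
        DirectSum.decompose_of_mem_ne (fun i : ℕ ↦ ⋀[ℚ]^i V) x.2 hik, map_zero]

/-- **The Künneth projectors commute with every `⋀f`: `π_k (⋀f X) = ⋀f (π_k X)`** ("The projection operator `H^*(A) → H^s(A)` commutes
with the action of `L(A)`" — indeed with every graded algebra map). [cite: Milne1999LefschetzClasses, §5 Cor. 5.8 (proof, p. 664)] -/
theorem map_proj {K : Type*} [Field K] {W W' : Type*} [AddCommGroup W] [Module K W] [AddCommGroup W'] [Module K W']
    (f : W →ₗ[K] W') (k : ℕ) (X : ExteriorAlgebra K W) :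
    ExteriorAlgebra.map f (GradedAlgebra.proj (fun i : ℕ ↦ ⋀[K]^i W) k X) =
      GradedAlgebra.proj (fun i : ℕ ↦ ⋀[K]^i W') k (ExteriorAlgebra.map f X) := by
  induction X using DirectSum.Decomposition.inductionOn (fun i : ℕ ↦ ⋀[K]^i W) with
  | zero => simp only [map_zero]
  | add x x' hx hx' => rw [map_add, map_add, hx, hx', map_add, map_add]
  | @homogeneous i x =>
    rw [GradedAlgebra.proj_apply, GradedAlgebra.proj_apply]
    by_cases hik : i = k
    · subst hik
      rw [DirectSum.decompose_of_mem_same (fun i : ℕ ↦ ⋀[K]^i W) x.2,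
        DirectSum.decompose_of_mem_same (fun i : ℕ ↦ ⋀[K]^i W') (map_mem_exteriorPower f x.2)]
    · rw [DirectSum.decompose_of_mem_ne (fun i : ℕ ↦ ⋀[K]^i W) x.2 hik,
        DirectSum.decompose_of_mem_ne (fun i : ℕ ↦ ⋀[K]^i W') (map_mem_exteriorPower f x.2) hik, map_zero]

/-- `⋀f ∘ π_k = π_k ∘ ⋀f` as an identity in `End`. [cite: Milne1999LefschetzClasses, §5 Cor. 5.8 (proof, p. 664)] -/
theorem map_comp_proj {K : Type*} [Field K] {W : Type*} [AddCommGroup W] [Module K W] (f : W →ₗ[K] W) (k : ℕ) :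
    (ExteriorAlgebra.map f).toLinearMap ∘ₗ GradedAlgebra.proj (fun i : ℕ ↦ ⋀[K]^i W) k =
      GradedAlgebra.proj (fun i : ℕ ↦ ⋀[K]^i W) k ∘ₗ (ExteriorAlgebra.map f).toLinearMap :=
  LinearMap.ext fun X ↦ map_proj f k X

/-- A complexification `T_ℂ` (`T_ℂ Θ = Θ T`) of a `ℚ`-linear operator is unique. [cite: BourbakiAlgebraI1989, Ch. III §7 no. 5 Prop. 8] -/
theorem toComplexAlg_linearMap_eq_of_comp_eq {V₂ : Type u} [AddCommGroup V₂] [Module ℚ V₂] {T : ExteriorAlgebra ℚ V →ₗ[ℚ] ExteriorAlgebra ℚ V₂}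
    {T₁ T₂ : ExteriorAlgebra ℂ (ℂ ⊗[ℚ] V) →ₗ[ℂ] ExteriorAlgebra ℂ (ℂ ⊗[ℚ] V₂)} (h₁ : ∀ x, T₁ (toComplexAlg V x) = toComplexAlg V₂ (T x))
    (h₂ : ∀ x, T₂ (toComplexAlg V x) = toComplexAlg V₂ (T x)) : T₁ = T₂ :=
  linearMap_ext_of_toComplexAlg fun x ↦ by rw [h₁, h₂]

variable {ω : ExteriorAlgebra ℚ V} {g : ℕ}

/-- **THE `ℚ → ℂ` DICTIONARY OF `ℚ[L, Λ]` (= `ℚ[e_ω, *_L]`)**: every `T ∈ ℚ[e_ω, *_L]` has a complexification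
`T_ℂ ∈ ℂ[e_{Θω}, *_{L,ℂ}]` with `T_ℂ (Θ x) = Θ (T x)` — by induction on the algebra: `Θ(ω ∧ x) = Θω ∧ Θx`, `Θ(*_L x) = *_{L,ℂ}(Θ x)`
(row g29-#6), sums, composites and scalars `r ∈ ℚ ⊂ ℂ` ("`Q_ν[L, *_L]`" for every coefficient field, André).
[cite: Milne1999LefschetzClasses, §5 Thm. 5.9 (proof, p. 665: "all elements of the ℚ-algebra ℚ[L, Λ]")] [cite: Andre1996Motifs, Prop. 1.2 (p. 11)] -/
theorem IsSymplectic.exists_mem_adjoin_lefschetzStar_toComplexAlg (hω : IsSymplectic ω g) (hωC : IsSymplectic (toComplexAlg V ω) g)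
    {T : Module.End ℚ (ExteriorAlgebra ℚ V)}
    (hT : T ∈ Algebra.adjoin ℚ ({LinearMap.mul ℚ (ExteriorAlgebra ℚ V) ω, lefschetzStar ω g} : Set (Module.End ℚ (ExteriorAlgebra ℚ V)))) :
    ∃ T' ∈ Algebra.adjoin ℂ ({LinearMap.mul ℂ (ExteriorAlgebra ℂ (ℂ ⊗[ℚ] V)) (toComplexAlg V ω), lefschetzStar (toComplexAlg V ω) g} :
        Set (Module.End ℂ (ExteriorAlgebra ℂ (ℂ ⊗[ℚ] V)))),
      ∀ x, T' (toComplexAlg V x) = toComplexAlg V (T x) := by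
  induction hT using Algebra.adjoin_induction with
  | mem T hT =>
    rw [Set.mem_insert_iff, Set.mem_singleton_iff] at hT
    rcases hT with rfl | rfl
    · exact ⟨LinearMap.mul ℂ (ExteriorAlgebra ℂ (ℂ ⊗[ℚ] V)) (toComplexAlg V ω), Algebra.subset_adjoin (Set.mem_insert _ _),
        fun x ↦ by rw [LinearMap.mul_apply', LinearMap.mul_apply', map_mul]⟩
    · exact ⟨lefschetzStar (toComplexAlg V ω) g, Algebra.subset_adjoin (Set.mem_insert_of_mem _ rfl),
        fun x ↦ (hω.toComplexAlg_lefschetzStar hωC x).symm⟩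
  | algebraMap r =>
    refine ⟨algebraMap ℂ _ (algebraMap ℚ ℂ r), Subalgebra.algebraMap_mem _ _, fun x ↦ ?_⟩
    rw [Module.algebraMap_end_apply, Module.algebraMap_end_apply, map_smul, algebraMap_smul]
  | add S T _ _ hS hT =>
    obtain ⟨S', hS', hSS⟩ := hS
    obtain ⟨T', hT', hTT⟩ := hT
    exact ⟨S' + T', add_mem hS' hT', fun x ↦ by rw [LinearMap.add_apply, LinearMap.add_apply, map_add, hSS, hTT]⟩
  | mul S T _ _ hS hT =>
    obtain ⟨S', hS', hSS⟩ := hS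
    obtain ⟨T', hT', hTT⟩ := hT
    exact ⟨S' * T', mul_mem hS' hT', fun x ↦ by rw [Module.End.mul_apply, Module.End.mul_apply, hTT, hSS]⟩

/-- **`Σ_{k ≤ 2g} π_k = id` on `⋀W`** for a symplectic `ω` of genus `g` (`⋀ᵏW = 0` for `k > 2g = dim W`).
[cite: Milne1999LefschetzClasses, §5 Cor. 5.8 (p. 664)] [cite: BourbakiAlgebraI1989, Ch. III §7 no. 8 Cor. 1] -/
theorem IsSymplectic.sum_range_proj_apply {K : Type*} [Field K] [CharZero K] {W : Type*} [AddCommGroup W] [Module K W]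
    {ω : ExteriorAlgebra K W} {g : ℕ} (hω : IsSymplectic ω g) (x : ExteriorAlgebra K W) :
    ∑ k ∈ Finset.range (2 * g + 1), GradedAlgebra.proj (fun i : ℕ ↦ ⋀[K]^i W) k x = x := by
  classical
  simp only [GradedAlgebra.proj_apply]
  conv_rhs => rw [← DirectSum.sum_support_decompose (fun i : ℕ ↦ ⋀[K]^i W) x]
  refine (Finset.sum_subset (fun i hi ↦ ?_) fun k _ hk ↦ ?_).symm
  · rw [Finset.mem_range]
    by_contra hgi
    have h0 : ((DirectSum.decompose (fun i : ℕ ↦ ⋀[K]^i W) x i : ⋀[K]^i W) : ExteriorAlgebra K W) = 0 :=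
      (Submodule.eq_bot_iff _).mp (hω.exteriorPower_eq_bot_of_lt i (by omega)) _ (DirectSum.decompose (fun i : ℕ ↦ ⋀[K]^i W) x i).2
    exact (DFinsupp.mem_support_iff.mp hi) (Subtype.ext h0)
  · rw [DFinsupp.notMem_support_iff.mp hk, ZeroMemClass.coe_zero]

/-- **`Σ_{k ≤ 2g} π_k = 1`** in `End(⋀W)`. [cite: Milne1999LefschetzClasses, §5 Cor. 5.8 (p. 664)] -/
theorem IsSymplectic.sum_range_proj {K : Type*} [Field K] [CharZero K] {W : Type*} [AddCommGroup W] [Module K W]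
    {ω : ExteriorAlgebra K W} {g : ℕ} (hω : IsSymplectic ω g) :
    ∑ k ∈ Finset.range (2 * g + 1), GradedAlgebra.proj (fun i : ℕ ↦ ⋀[K]^i W) k = LinearMap.id := by
  refine LinearMap.ext fun x ↦ ?_
  rw [LinearMap.sum_apply, hω.sum_range_proj_apply x, LinearMap.id_apply]

end ExteriorLefschetz

/-! ## §2 Thm. 5.9 as printed: the classes of the elements of `ℚ[L, Λ]` are Lefschetz -/

namespace HodgeStructure

open ExteriorLefschetz ExteriorAlgebra

variable {V : Type u} [AddCommGroup V] [Module ℚ V] [Module.Finite ℚ V] {n : ℤ} {H : HodgeStructure V n} (Q : Polarization H)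
  (hn : Odd n) {g : ℕ} (hg : Module.finrank ℚ V = 2 * g)

/-- **THM. 5.9 AS PRINTED, GENERAL FORM — "all elements of the `ℚ`-algebra `ℚ[L, Λ]` are Lefschetz": for every `T ∈ ℚ[e_E, *_L]` the
correspondence `[T] ∈ H•(A × A) = ⋀(V ⊕ V)` realising `T` lies in `ℚ[B¹(H ⊕ H)]`** (`T_ℂ ∈ ℂ[e_{ΘE}, *_{L,ℂ}]` commutes with the action
of `S(H)(ℂ)` — "it commutes with the action of `L(A)` […] which is therefore Lefschetz" — and Prop. 5.7).
[cite: Milne1999LefschetzClasses, §5 Thm. 5.9 (pp. 664–665) and Prop. 5.7 (p. 664)] -/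
theorem Polarization.corrEquiv_symm_mem_adjoin_hodgeClasses_two_of_mem_adjoin_lefschetzStar {T : Module.End ℚ (ExteriorAlgebra ℚ V)}
    (hT : T ∈ Algebra.adjoin ℚ ({LinearMap.mul ℚ (ExteriorAlgebra ℚ V) (Q.lefschetzClass : ExteriorAlgebra ℚ V),
      lefschetzStar (Q.lefschetzClass : ExteriorAlgebra ℚ V) g} : Set (Module.End ℚ (ExteriorAlgebra ℚ V)))) :
    (Q.isSymplectic_lefschetzClass hn hg).corrEquiv.symm T ∈
      Algebra.adjoin ℚ ((((H.prod H).exteriorPower 2).hodgeClasses n).map (⋀[ℚ]^2 (V × V)).subtype : Set (ExteriorAlgebra ℚ (V × V))) := by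
  obtain ⟨T', hT', hTT⟩ := (Q.isSymplectic_lefschetzClass hn hg).exists_mem_adjoin_lefschetzStar_toComplexAlg
    (Q.isSymplectic_toComplexAlg_lefschetzClass hn hg) hT
  rw [Q.corrEquiv_symm_mem_adjoin_hodgeClasses_two_prod_self_iff hn hg hTT]
  intro γ hγ
  exact (Q.commute_map_of_mem_adjoin_lefschetzStar hn hg hγ hT').eq

/-- **`[L]` is Lefschetz**: the class of `L = e_E = E ∧ ·` ("Since the latter is Lefschetz …": `L` is cupping with the Lefschetz class `E`).
[cite: Milne1999LefschetzClasses, §5 Thm. 5.9 (proof, p. 665)] -/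
theorem Polarization.corrEquiv_symm_mul_lefschetzClass_mem_adjoin_hodgeClasses_two :
    (Q.isSymplectic_lefschetzClass hn hg).corrEquiv.symm (LinearMap.mul ℚ (ExteriorAlgebra ℚ V) (Q.lefschetzClass : ExteriorAlgebra ℚ V)) ∈
      Algebra.adjoin ℚ ((((H.prod H).exteriorPower 2).hodgeClasses n).map (⋀[ℚ]^2 (V × V)).subtype : Set (ExteriorAlgebra ℚ (V × V))) :=
  Q.corrEquiv_symm_mem_adjoin_hodgeClasses_two_of_mem_adjoin_lefschetzStar hn hg (Algebra.subset_adjoin (Set.mem_insert _ _))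

/-- **`[*_L]` is Lefschetz** ("`Λ`, regarded as a map of cohomology groups, is inverse to `L`" — `*_L` is `L^{d-j}` on `Hʲ` and its inverse
on `H^{2d-j}`). [cite: Milne1999LefschetzClasses, §5 Thm. 5.9 (proof, p. 665)] [cite: Andre1996Motifs, §1.1 (p. 10)] -/
theorem Polarization.corrEquiv_symm_lefschetzStar_mem_adjoin_hodgeClasses_two :
    (Q.isSymplectic_lefschetzClass hn hg).corrEquiv.symm (lefschetzStar (Q.lefschetzClass : ExteriorAlgebra ℚ V) g) ∈
      Algebra.adjoin ℚ ((((H.prod H).exteriorPower 2).hodgeClasses n).map (⋀[ℚ]^2 (V × V)).subtype : Set (ExteriorAlgebra ℚ (V × V))) :=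
  Q.corrEquiv_symm_mem_adjoin_hodgeClasses_two_of_mem_adjoin_lefschetzStar hn hg (Algebra.subset_adjoin (Set.mem_insert_of_mem _ rfl))

/-- **THM. 5.9 FOR `Λ`: the correspondence `Λ = *_L L *_L` ("`Λx = Σ L^{i−1} xᵢ`") is Lefschetz.**
[cite: Milne1999LefschetzClasses, §5 Thm. 5.9 (pp. 664–665)] [cite: Andre1996Motifs, Prop. 1.2 (p. 11, "Q_ν[L, *_L L *_L]")] -/
theorem Polarization.corrEquiv_symm_conj_lefschetzStar_mem_adjoin_hodgeClasses_two :
    (Q.isSymplectic_lefschetzClass hn hg).corrEquiv.symm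
        (lefschetzStar (Q.lefschetzClass : ExteriorAlgebra ℚ V) g * LinearMap.mul ℚ (ExteriorAlgebra ℚ V) (Q.lefschetzClass : ExteriorAlgebra ℚ V) *
          lefschetzStar (Q.lefschetzClass : ExteriorAlgebra ℚ V) g) ∈
      Algebra.adjoin ℚ ((((H.prod H).exteriorPower 2).hodgeClasses n).map (⋀[ℚ]^2 (V × V)).subtype : Set (ExteriorAlgebra ℚ (V × V))) :=
  Q.corrEquiv_symm_mem_adjoin_hodgeClasses_two_of_mem_adjoin_lefschetzStar hn hg
    (mul_mem (mul_mem (Algebra.subset_adjoin (Set.mem_insert_of_mem _ rfl)) (Algebra.subset_adjoin (Set.mem_insert _ _)))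
      (Algebra.subset_adjoin (Set.mem_insert_of_mem _ rfl)))

/-- **THM. 5.9 FOR `ᶜΛ`: the correspondence `ᶜΛ` ("`ᶜΛx = Σ i(d−s+i+1) L^{i−1} xᵢ`", the `𝔰𝔩₂`-partner of `L`; `g ≥ 1`) is Lefschetz.**
[cite: Milne1999LefschetzClasses, §5 Thm. 5.9 (pp. 664–665)] [cite: Kleiman1968AlgebraicCycles, §1.4, 1.4.4] -/
theorem Polarization.corrEquiv_symm_lefschetzDual_mem_adjoin_hodgeClasses_two (hg0 : 0 < g) :
    (Q.isSymplectic_lefschetzClass hn hg).corrEquiv.symm (lefschetzDual (Q.lefschetzClass : ExteriorAlgebra ℚ V) g) ∈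
      Algebra.adjoin ℚ ((((H.prod H).exteriorPower 2).hodgeClasses n).map (⋀[ℚ]^2 (V × V)).subtype : Set (ExteriorAlgebra ℚ (V × V))) :=
  Q.corrEquiv_symm_mem_adjoin_hodgeClasses_two_of_mem_adjoin_lefschetzStar hn hg
    ((Q.isSymplectic_lefschetzClass hn hg).lefschetzDual_mem_adjoin_lefschetzStar hg0)

/-- **THM. 5.9 FOR `∗`: the correspondence `∗` ("`∗x = Σ (−1)^{(s−2i)(s−2i+1)/2} L^{d−s+i} xᵢ`") is Lefschetz.**
[cite: Milne1999LefschetzClasses, §5 Thm. 5.9 (pp. 664–665)] [cite: Kleiman1968AlgebraicCycles, §1.4, 1.4.4] -/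
theorem Polarization.corrEquiv_symm_hodgeStar_mem_adjoin_hodgeClasses_two :
    (Q.isSymplectic_lefschetzClass hn hg).corrEquiv.symm (hodgeStar (Q.lefschetzClass : ExteriorAlgebra ℚ V) g) ∈
      Algebra.adjoin ℚ ((((H.prod H).exteriorPower 2).hodgeClasses n).map (⋀[ℚ]^2 (V × V)).subtype : Set (ExteriorAlgebra ℚ (V × V))) :=
  Q.corrEquiv_symm_mem_adjoin_hodgeClasses_two_of_mem_adjoin_lefschetzStar hn hg
    (Q.isSymplectic_lefschetzClass hn hg).hodgeStar_mem_adjoin_lefschetzStar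

/-- **The class of André's Weyl element `w = exp(ᶜΛ) exp(−L) exp(ᶜΛ)` is Lefschetz** (`w ∈ ℚ[e_E, *_L]`, row g31-#3).
[cite: Milne1999LefschetzClasses, §5 Thm. 5.9 (pp. 664–665)] [cite: Andre1996Motifs, §1.2 and Prop. 1.2 (p. 11)] -/
theorem Polarization.corrEquiv_symm_weylStar_mem_adjoin_hodgeClasses_two :
    (Q.isSymplectic_lefschetzClass hn hg).corrEquiv.symm (weylStar (Q.lefschetzClass : ExteriorAlgebra ℚ V) g) ∈
      Algebra.adjoin ℚ ((((H.prod H).exteriorPower 2).hodgeClasses n).map (⋀[ℚ]^2 (V × V)).subtype : Set (ExteriorAlgebra ℚ (V × V))) :=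
  Q.corrEquiv_symm_mem_adjoin_hodgeClasses_two_of_mem_adjoin_lefschetzStar hn hg
    (Q.isSymplectic_lefschetzClass hn hg).weylStar_mem_adjoin_lefschetzStar

/-- **The class of André's involution `*_H` is Lefschetz** (`*_H ∈ ℚ[e_E, *_L]`, row g31-#3).
[cite: Milne1999LefschetzClasses, §5 Thm. 5.9 (pp. 664–665)] [cite: Andre1996Motifs, Prop. 1.2 (p. 11)] -/
theorem Polarization.corrEquiv_symm_andreStar_mem_adjoin_hodgeClasses_two :
    (Q.isSymplectic_lefschetzClass hn hg).corrEquiv.symm (andreStar (Q.lefschetzClass : ExteriorAlgebra ℚ V) g) ∈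
      Algebra.adjoin ℚ ((((H.prod H).exteriorPower 2).hodgeClasses n).map (⋀[ℚ]^2 (V × V)).subtype : Set (ExteriorAlgebra ℚ (V × V))) :=
  Q.corrEquiv_symm_mem_adjoin_hodgeClasses_two_of_mem_adjoin_lefschetzStar hn hg
    (Q.isSymplectic_lefschetzClass hn hg).andreStar_mem_adjoin_lefschetzStar

/-! ## §3 Cor. 5.8 as printed: the Künneth components of the diagonal are Lefschetz -/

/-- **COR. 5.8 AS PRINTED — "the Künneth components of the diagonal are Lefschetz"**: the class `[π_k] ∈ H•(A × A)` of the Künneth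
projector `π_k : H•(A) → Hᵏ(A) ⊂ H•(A)` lies in `ℚ[B¹(H ⊕ H)]`, for every `k` — Milne's proof verbatim: "The projection operator
`H^*(A) → H^s(A)` commutes with the action of `L(A)`" (its complexification is the projector of `⋀_ℂ V_ℂ`, which commutes with every
`⋀γ`), then Prop. 5.7. [cite: Milne1999LefschetzClasses, §5 Cor. 5.8 (p. 664)] -/
theorem Polarization.corrEquiv_symm_proj_mem_adjoin_hodgeClasses_two (k : ℕ) :
    (Q.isSymplectic_lefschetzClass hn hg).corrEquiv.symm (GradedAlgebra.proj (fun i : ℕ ↦ ⋀[ℚ]^i V) k) ∈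
      Algebra.adjoin ℚ ((((H.prod H).exteriorPower 2).hodgeClasses n).map (⋀[ℚ]^2 (V × V)).subtype : Set (ExteriorAlgebra ℚ (V × V))) := by
  rw [Q.corrEquiv_symm_mem_adjoin_hodgeClasses_two_prod_self_iff hn hg (proj_toComplexAlg k)]
  intro γ _
  exact map_comp_proj _ k

/-- **`Σ_{k ≤ 2g} [π_k] = [id]`: the `[π_k]` ARE the Künneth components of the class `[Δ] = [id]` of the diagonal** (the correspondence
realising the identity; `u ↦ [u]` is linear and `Σ_{k ≤ 2g} π_k = id`). [cite: Milne1999LefschetzClasses, §5 Cor. 5.8 (p. 664) and Cor. 5.6 (p. 663, Γ_α = (id, α)_*(1))]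
[cite: VoisinHodgeI2002, §11.3.3 p. 287 ("The sum Σ_k Id_k is equal to the cohomology class of the diagonal")] -/
theorem Polarization.sum_corrEquiv_symm_proj :
    ∑ k ∈ Finset.range (2 * g + 1), (Q.isSymplectic_lefschetzClass hn hg).corrEquiv.symm (GradedAlgebra.proj (fun i : ℕ ↦ ⋀[ℚ]^i V) k) =
      (Q.isSymplectic_lefschetzClass hn hg).corrEquiv.symm (LinearMap.id : ExteriorAlgebra ℚ V →ₗ[ℚ] ExteriorAlgebra ℚ V) := by
  rw [← map_sum, (Q.isSymplectic_lefschetzClass hn hg).sum_range_proj]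

/-- **The class of the diagonal `[Δ] = [id]` is Lefschetz** (Cor. 5.6 for `α = id`; here: the identity commutes with everything).
[cite: Milne1999LefschetzClasses, §5 Cor. 5.6 (p. 663) and Cor. 5.8 (p. 664)] -/
theorem Polarization.corrEquiv_symm_id_mem_adjoin_hodgeClasses_two :
    (Q.isSymplectic_lefschetzClass hn hg).corrEquiv.symm (LinearMap.id : ExteriorAlgebra ℚ V →ₗ[ℚ] ExteriorAlgebra ℚ V) ∈
      Algebra.adjoin ℚ ((((H.prod H).exteriorPower 2).hodgeClasses n).map (⋀[ℚ]^2 (V × V)).subtype : Set (ExteriorAlgebra ℚ (V × V))) := by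
  rw [Q.corrEquiv_symm_mem_adjoin_hodgeClasses_two_prod_self_iff hn hg (T' := LinearMap.id) fun x ↦ rfl]
  intro γ _
  rw [LinearMap.comp_id, LinearMap.id_comp]

end HodgeStructure

end Literature.AlgebraicGeometry.Motives
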